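import Mathlib
import HarnessLib
import Summits.Ventures.LatticeQCDFlow.Exactness.GaugeFieldLocality
import Summits.Ventures.LatticeQCDFlow.Exactness.LatticeCoveringPullback
import Summits.Ventures.LatticeQCDFlow.Exactness.SU2WilsonFlowLOTranslation
import Summits.Ventures.LatticeQCDFlow.Exactness.LatticeForceVolumeUniform

/-!
# WINDOW-STENCIL CONDITIONERS ARE COVERING-NATURAL, TRANSLATION-COVARIANT AND LOCAL: a learned weight that is a FIXED readout of the (masked) plaquette features in the `m`-window around the link — a periodic CNN of depth `m` is one — satisfies the hypotheses (ρN), (ρT), (ρL) of the GEN-16 volume-uniformity chain, on every torus and for the whole family of tori at once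

HONEST FRAMING: exact (Metropolis-corrected) sampling algorithms for lattice gauge theory;
figures of merit are autocorrelation/cost numbers at stated couplings and volumes; no
continuum-physics claim.

Venture `LatticeQCDFlow` (cell pub-lqcd), topic `Exactness`; FANOUT row 14 (`eng-flowhmc`, engine
`latflow.fthmc`, family B; the learned residual member's conditioner `maps.residual_context_flat` —
per-site features `(Re, Im) tr U_p / N` of the plaquettes at the site, masked to the frozen ones by a
rule reading the site's phase `Σᵢ xᵢ mod w`, the layer's direction and phase — followed by
`flows_jax.nn.cnn_apply`, a periodic CNN of kernel 3 and depth `m`, and `(κ/J) tanh`).  NEW WORK of the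
cell over the tree (`GaugeFieldLocality`: neighbourhoods, `plaquetteHolonomy_congr`;
`LatticeCoveringPullback`: `plaquetteHolonomy_pull`, site maps; `SU2WilsonFlowLOTranslation`:
`plaquetteHolonomy_translate`; `LatticeForceVolumeUniform`: `phaseMask_pull`); any link group `G`;
nothing is cited as a fact; no number.  GEN-16 programme: it DISCHARGES the three geometric
hypotheses of `SU2ResidualExactForceVolumeUniform` for a CLASS of conditioners stated VERBATIM (no
definition is introduced):

  `ρ s V e ν t = ψ s e.2 ν t (z ↦ feat s (χ (e.1 + z)) ((μ', ν') ↦ U_{μ'ν'}(V)(e.1 + z)))`,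
  `z` ranging over the window `{z : Fin d → ℤ // ∀ i, |z i| ≤ m}`,

with ANY per-site feature map `feat : σ → X → (Fin d → Fin d → G) → Φ` (features of the plaquettes at a
site given its colour — masks included) and ANY readout `ψ : σ → Fin d → Fin d → Fin 2 → (window → Φ) → ℝ`
shared by all sites (weight sharing).  A periodic CNN of depth `m` and kernel 3 evaluated on per-site
features is such a readout (its output at `x` is a fixed function of the features at `x + z`,
`|zᵢ| ≤ m`); so is any composition with a pointwise squash.

* **`stencilConditioner_pull`** — (ρN): for `φ : ZMod L' →+* ZMod L` and colourings `χ' = χ∘σ`,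
  `ρ'_s(V∘σ̂)(e') = ρ_s(V)(σ̂ e')` (the SAME `ψ`, `feat` on both tori);
* **`stencilConditioner_translate`** — (ρT): for translations `t` preserving `χ`,
  `ρ_s(W·t)(e) = ρ_s(W)(e + t)`;
* **`stencilConditioner_local`** — (ρL) with receptive radius `m`: if `U, U'` agree on the
  `(r+m+1)`-ball at `x` then `ρ_s(U)(e) = ρ_s(U')(e)` for every `e` with `e.1` `r`-near `x`;
* **`stencilConditioner_family_natural`**, **`stencilConditioner_family_translate`**,
  **`stencilConditioner_family_local`** — the same for the FAMILY `M ↦ ρ^{(M)}` built with the phase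
  masks `x ↦ Σᵢ xᵢ mod w` on every torus `w ∣ M`: literally the hypotheses (ρN) (along every
  `ZMod.castHom`, `M ∣ M'`), (ρT) (mask-preserving translations) and (ρL) of
  `su2Residual_exactForce_regular_uniform` / `su2Residual_member_fthmcN_exactForce_uniformlyErgodic_allVolumes`.

NOT CLAIMED: (ρm)/(ρD)/(ρC) (measurability / smoothness of `ψ ∘ feat` — network-side), (ρloc) (needs the
mask to kill every plaquette through an active link — by construction in the engine, not typed here),
(ρκ) (the tanh squash — `SU2ResidualSquash`); that a given checkpoint's preprocessing is of this form;
any number.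
-/

noncomputable section

namespace Summit.Ventures.LatticeQCDFlow.Exactness

open Literature.MathematicalPhysics.QuantumFieldTheory

/-! ## §1 One torus: pull-back, translation, locality -/

section Stencil

variable {d L L' : ℕ} (φ : ZMod L' →+* ZMod L) {G : Type*} [Group G] {X : Type*} {σ : Type*} {Φ : Type*}
  (χ : Site d L → X) (χ' : Site d L' → X) (m : ℕ)
  (feat : σ → X → (Fin d → Fin d → G) → Φ)
  (ψ : σ → Fin d → Fin d → Fin 2 → ({z : Fin d → ℤ // ∀ i, |z i| ≤ ((m : ℕ) : ℤ)} → Φ) → ℝ)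

/-- The site map `x ↦ (φ xᵢ)ᵢ` commutes with adding an integer window vector. -/
theorem siteMap_add_intCast (x : Site d L') (z : Fin d → ℤ) :
    (fun k => φ ((x + fun i => ((z i : ℤ) : ZMod L')) k)) = (fun k => φ (x k)) + fun i => ((z i : ℤ) : ZMod L) := by
  funext k
  simp only [Pi.add_apply, map_add, map_intCast]

/-- **(ρN) WINDOW-STENCIL CONDITIONERS ARE COVERING-NATURAL**: with colourings `χ' = χ ∘ σ` and the same
readout / features on both tori, the weight of the pulled-back field at `e'` is the weight of the field at
`σ̂ e'`. -/
theorem stencilConditioner_pull (hχ : ∀ x : Site d L', χ' x = χ (fun j => φ (x j))) (s : σ)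
    (V : GaugeConfig d L G) (e : Edge d L') (ν : Fin d) (t : Fin 2) :
    (ψ s e.2 ν t (fun z : {z : Fin d → ℤ // ∀ i, |z i| ≤ ((m : ℕ) : ℤ)} =>
          feat s (χ' (e.1 + (fun i => ((z.1 i : ℤ) : ZMod L')))) (fun μ' ν' => plaquetteHolonomy (fun e : Edge d L' => V (fun i => φ (e.1 i), e.2)) (e.1 + (fun i => ((z.1 i : ℤ) : ZMod L'))) μ' ν'))) =
      (ψ s ((fun j => φ (e.1 j)), e.2).2 ν t (fun z : {z : Fin d → ℤ // ∀ i, |z i| ≤ ((m : ℕ) : ℤ)} =>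
          feat s (χ (((fun j => φ (e.1 j)), e.2).1 + (fun i => ((z.1 i : ℤ) : ZMod L)))) (fun μ' ν' => plaquetteHolonomy V (((fun j => φ (e.1 j)), e.2).1 + (fun i => ((z.1 i : ℤ) : ZMod L))) μ' ν'))) := by
  congr 1
  funext ζ
  have h1 : χ' (e.1 + fun i => ((ζ.1 i : ℤ) : ZMod L')) = χ ((fun k => φ (e.1 k)) + fun i => ((ζ.1 i : ℤ) : ZMod L)) := by
    rw [hχ, siteMap_add_intCast]
  have h2 : (fun μ' ν' => plaquetteHolonomy (fun e : Edge d L' => V (fun i => φ (e.1 i), e.2)) (e.1 + fun i => ((ζ.1 i : ℤ) : ZMod L')) μ' ν') =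
      fun μ' ν' => plaquetteHolonomy V ((fun k => φ (e.1 k)) + fun i => ((ζ.1 i : ℤ) : ZMod L)) μ' ν' := by
    funext μ' ν'
    rw [plaquetteHolonomy_pull, siteMap_add_intCast]
  rw [h1, h2]

/-- **(ρT) WINDOW-STENCIL CONDITIONERS ARE TRANSLATION COVARIANT** under the translations preserving the
colouring: `ρ_s(W·t)(e) = ρ_s(W)(e + t)`. -/
theorem stencilConditioner_translate (tr : Site d L) (hχ : ∀ x : Site d L, χ (x + tr) = χ x) (s : σ)
    (W : GaugeConfig d L G) (e : Edge d L) (ν : Fin d) (b : Fin 2) :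
    (ψ s e.2 ν b (fun z : {z : Fin d → ℤ // ∀ i, |z i| ≤ ((m : ℕ) : ℤ)} =>
          feat s (χ (e.1 + (fun i => ((z.1 i : ℤ) : ZMod L)))) (fun μ' ν' => plaquetteHolonomy (fun e : Edge d L => W (e.1 + tr, e.2)) (e.1 + (fun i => ((z.1 i : ℤ) : ZMod L))) μ' ν'))) =
      (ψ s ((e.1 + tr), e.2).2 ν b (fun z : {z : Fin d → ℤ // ∀ i, |z i| ≤ ((m : ℕ) : ℤ)} =>
          feat s (χ (((e.1 + tr), e.2).1 + (fun i => ((z.1 i : ℤ) : ZMod L)))) (fun μ' ν' => plaquetteHolonomy W (((e.1 + tr), e.2).1 + (fun i => ((z.1 i : ℤ) : ZMod L))) μ' ν'))) := by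
  congr 1
  funext ζ
  have hs : (e.1 + fun i => ((ζ.1 i : ℤ) : ZMod L)) + tr = e.1 + tr + (fun i => ((ζ.1 i : ℤ) : ZMod L)) := by
    abel
  have h1 : χ (e.1 + fun i => ((ζ.1 i : ℤ) : ZMod L)) = χ (e.1 + tr + fun i => ((ζ.1 i : ℤ) : ZMod L)) := by
    rw [← hs, hχ]
  have h2 : (fun μ' ν' => plaquetteHolonomy (fun e : Edge d L => W (e.1 + tr, e.2)) (e.1 + fun i => ((ζ.1 i : ℤ) : ZMod L)) μ' ν') =
      fun μ' ν' => plaquetteHolonomy W (e.1 + tr + fun i => ((ζ.1 i : ℤ) : ZMod L)) μ' ν' := by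
    funext μ' ν'
    rw [plaquetteHolonomy_translate, hs]
  rw [h1, h2]

/-- An integer window vector is an `m`-near step. -/
theorem near_add_window (x : Site d L) (ζ : {z : Fin d → ℤ // ∀ i, |z i| ≤ ((m : ℕ) : ℤ)}) :
    (∃ z : Fin d → ℤ, (∀ i, |z i| ≤ ((m : ℕ) : ℤ)) ∧ (x + fun i => ((ζ.1 i : ℤ) : ZMod L)) = x + fun i => ((z i : ℤ) : ZMod L)) :=
  ⟨ζ.1, ζ.2, rfl⟩

/-- **(ρL) WINDOW-STENCIL CONDITIONERS HAVE RECEPTIVE RADIUS `m`**: if `U, U'` agree on the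
`(r+m+1)`-ball at `x`, the weights agree at every link based `r`-near `x` (each plaquette in the window
reads links `1`-near a site `m`-near the base point). -/
theorem stencilConditioner_local (s : σ) (U U' : GaugeConfig d L G) (x : Site d L) (r : ℕ)
    (h : (∀ e : Edge d L, (∃ z : Fin d → ℤ, (∀ i, |z i| ≤ (((r+m+1) : ℕ) : ℤ)) ∧ e.1 = x + fun i => ((z i : ℤ) : ZMod L)) → U e = U' e)) (e₀ : Edge d L) (he : (∃ z : Fin d → ℤ, (∀ i, |z i| ≤ ((r : ℕ) : ℤ)) ∧ e₀.1 = x + fun i => ((z i : ℤ) : ZMod L)))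
    (ν : Fin d) (t : Fin 2) :
    (ψ s e₀.2 ν t (fun z : {z : Fin d → ℤ // ∀ i, |z i| ≤ ((m : ℕ) : ℤ)} =>
          feat s (χ (e₀.1 + (fun i => ((z.1 i : ℤ) : ZMod L)))) (fun μ' ν' => plaquetteHolonomy U (e₀.1 + (fun i => ((z.1 i : ℤ) : ZMod L))) μ' ν'))) =
      (ψ s e₀.2 ν t (fun z : {z : Fin d → ℤ // ∀ i, |z i| ≤ ((m : ℕ) : ℤ)} =>
          feat s (χ (e₀.1 + (fun i => ((z.1 i : ℤ) : ZMod L)))) (fun μ' ν' => plaquetteHolonomy U' (e₀.1 + (fun i => ((z.1 i : ℤ) : ZMod L))) μ' ν'))) := by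
  congr 1
  funext ζ
  have hy : (∃ z : Fin d → ℤ, (∀ i, |z i| ≤ (((r+m) : ℕ) : ℤ)) ∧ (e₀.1 + fun i => ((ζ.1 i : ℤ) : ZMod L)) = x + fun i => ((z i : ℤ) : ZMod L)) :=
    near_triangle he (near_add_window m e₀.1 ζ)
  have hball : (∀ e : Edge d L, (∃ z : Fin d → ℤ, (∀ i, |z i| ≤ ((1 : ℕ) : ℤ)) ∧ e.1 = (e₀.1 + fun i => ((ζ.1 i : ℤ) : ZMod L)) + fun i => ((z i : ℤ) : ZMod L)) → U e = U' e) := fun e' he' =>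
    h e' (near_triangle hy he')
  have h2 : (fun μ' ν' => plaquetteHolonomy U (e₀.1 + fun i => ((ζ.1 i : ℤ) : ZMod L)) μ' ν') =
      fun μ' ν' => plaquetteHolonomy U' (e₀.1 + fun i => ((ζ.1 i : ℤ) : ZMod L)) μ' ν' := by
    funext μ' ν'
    exact plaquetteHolonomy_congr hball μ' ν'
  rw [h2]

end Stencil

/-! ## §2 The family on all tori with the phase colouring: literally the hypotheses (ρN), (ρT), (ρL) of `SU2ResidualExactForceVolumeUniform` -/

section Family

variable {d : ℕ} (w : ℕ) {G : Type*} [Group G] {σ : Type*} {Φ : Type*} (m : ℕ)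
  (feat : σ → ZMod w → (Fin d → Fin d → G) → Φ)
  (ψ : σ → Fin d → Fin d → Fin 2 → ({z : Fin d → ℤ // ∀ i, |z i| ≤ ((m : ℕ) : ℤ)} → Φ) → ℝ)

/-- **(ρN) for the stencil family**: on every pair of tori `w ∣ M ∣ M'`, along `ZMod.castHom`, the
conditioner built on side `M'` from the SAME `ψ`, `feat` and the phase colouring `x ↦ Σᵢ xᵢ mod w`
(written as a bare cast) takes, at the pulled-back field, the pulled-back weights. -/
theorem stencilConditioner_family_natural :
    ∀ (M M' : ℕ) (hwM : w ∣ M) (hMM : M ∣ M') (s : σ) (V : GaugeConfig d M G) (e : Edge d M') (ν : Fin d) (t : Fin 2),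
      (ψ s e.2 ν t (fun z : {z : Fin d → ℤ // ∀ i, |z i| ≤ ((m : ℕ) : ℤ)} =>
          feat s (ZMod.cast (∑ j, (e.1 + (fun i => ((z.1 i : ℤ) : ZMod M'))) j) : ZMod w) (fun μ' ν' => plaquetteHolonomy (fun e : Edge d M' => V (fun i => ZMod.castHom hMM (ZMod M) (e.1 i), e.2)) (e.1 + (fun i => ((z.1 i : ℤ) : ZMod M'))) μ' ν'))) =
      (ψ s ((fun j => ZMod.castHom hMM (ZMod M) (e.1 j)), e.2).2 ν t (fun z : {z : Fin d → ℤ // ∀ i, |z i| ≤ ((m : ℕ) : ℤ)} =>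
          feat s (ZMod.cast (∑ j, (((fun j => ZMod.castHom hMM (ZMod M) (e.1 j)), e.2).1 + (fun i => ((z.1 i : ℤ) : ZMod M))) j) : ZMod w) (fun μ' ν' => plaquetteHolonomy V (((fun j => ZMod.castHom hMM (ZMod M) (e.1 j)), e.2).1 + (fun i => ((z.1 i : ℤ) : ZMod M))) μ' ν'))) := by
  intro M M' hwM hMM s V e ν t
  have hχ : ∀ x : Site d M', (ZMod.cast (∑ j, x j) : ZMod w) =
      (ZMod.cast (∑ j, (fun k => ZMod.castHom hMM (ZMod M) (x k)) j) : ZMod w) := by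
    intro x
    simpa only [ZMod.castHom_apply] using phaseMask_pull (dvd_trans hwM hMM) hwM hMM x
  exact stencilConditioner_pull (ZMod.castHom hMM (ZMod M)) (fun y : Site d M => (ZMod.cast (∑ j, y j) : ZMod w))
    (fun y : Site d M' => (ZMod.cast (∑ j, y j) : ZMod w)) m feat ψ hχ s V e ν t

/-- **(ρT) for the stencil family**: on every torus `w ∣ M`, covariance under every translation that
preserves the phase mask. -/
theorem stencilConditioner_family_translate :
    ∀ (M : ℕ) (hwM : w ∣ M) (t : Site d M), (∀ x : Site d M, ZMod.castHom hwM (ZMod w) (∑ j, (x + t) j) = ZMod.castHom hwM (ZMod w) (∑ j, x j)) →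
      ∀ (s : σ) (W : GaugeConfig d M G) (e : Edge d M) (ν : Fin d) (b : Fin 2),
      (ψ s e.2 ν b (fun z : {z : Fin d → ℤ // ∀ i, |z i| ≤ ((m : ℕ) : ℤ)} =>
          feat s (ZMod.cast (∑ j, (e.1 + (fun i => ((z.1 i : ℤ) : ZMod M))) j) : ZMod w) (fun μ' ν' => plaquetteHolonomy (fun e : Edge d M => W (e.1 + t, e.2)) (e.1 + (fun i => ((z.1 i : ℤ) : ZMod M))) μ' ν'))) =
      (ψ s ((e.1 + t), e.2).2 ν b (fun z : {z : Fin d → ℤ // ∀ i, |z i| ≤ ((m : ℕ) : ℤ)} =>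
          feat s (ZMod.cast (∑ j, (((e.1 + t), e.2).1 + (fun i => ((z.1 i : ℤ) : ZMod M))) j) : ZMod w) (fun μ' ν' => plaquetteHolonomy W (((e.1 + t), e.2).1 + (fun i => ((z.1 i : ℤ) : ZMod M))) μ' ν'))) := by
  intro M hwM t ht s W e ν b
  have hχ : ∀ x : Site d M, (ZMod.cast (∑ j, (x + t) j) : ZMod w) = (ZMod.cast (∑ j, x j) : ZMod w) := by
    intro x
    simpa only [ZMod.castHom_apply] using ht x
  exact stencilConditioner_translate (fun y : Site d M => (ZMod.cast (∑ j, y j) : ZMod w)) m feat ψ t hχ s W e ν b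

/-- **(ρL) for the stencil family**: receptive radius `m` on every torus. -/
theorem stencilConditioner_family_local :
    ∀ (M : ℕ) (s : σ) (U U' : GaugeConfig d M G) (x : Site d M) (r : ℕ),
      (∀ e : Edge d M, (∃ z : Fin d → ℤ, (∀ i, |z i| ≤ (((r+m+1) : ℕ) : ℤ)) ∧ e.1 = x + fun i => ((z i : ℤ) : ZMod M)) → U e = U' e) →
      ∀ e : Edge d M, (∃ z : Fin d → ℤ, (∀ i, |z i| ≤ ((r : ℕ) : ℤ)) ∧ e.1 = x + fun i => ((z i : ℤ) : ZMod M)) → ∀ (ν : Fin d) (t : Fin 2),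
      (ψ s e.2 ν t (fun z : {z : Fin d → ℤ // ∀ i, |z i| ≤ ((m : ℕ) : ℤ)} =>
          feat s (ZMod.cast (∑ j, (e.1 + (fun i => ((z.1 i : ℤ) : ZMod M))) j) : ZMod w) (fun μ' ν' => plaquetteHolonomy U (e.1 + (fun i => ((z.1 i : ℤ) : ZMod M))) μ' ν'))) =
      (ψ s e.2 ν t (fun z : {z : Fin d → ℤ // ∀ i, |z i| ≤ ((m : ℕ) : ℤ)} =>
          feat s (ZMod.cast (∑ j, (e.1 + (fun i => ((z.1 i : ℤ) : ZMod M))) j) : ZMod w) (fun μ' ν' => plaquetteHolonomy U' (e.1 + (fun i => ((z.1 i : ℤ) : ZMod M))) μ' ν'))) :=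
  fun M s U U' x r h e he ν t =>
    stencilConditioner_local (fun y : Site d M => (ZMod.cast (∑ j, y j) : ZMod w)) m feat ψ s U U' x r h e he ν t

end Family

/-! ## §3 Masked features: the weights at active links do not read active links (ρloc) -/

section Masked

variable {d : ℕ} (w : ℕ) {G : Type*} [Group G] {σ : Type*} {Φ : Type*} (m : ℕ)
  (μf : σ → Fin d) (bf : σ → ZMod w)
  (feat : σ → ZMod w → (Fin d → Fin d → G) → Φ)
  (ψ : σ → Fin d → Fin d → Fin 2 → ({z : Fin d → ℤ // ∀ i, |z i| ≤ ((m : ℕ) : ℤ)} → Φ) → ℝ)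

/-- A plaquette holonomy only reads its four links. -/
theorem plaquetteHolonomy_congr_links {M : ℕ} {V W : GaugeConfig d M G} {y : Site d M} {i j : Fin d}
    (h1 : V (y, i) = W (y, i)) (h2 : V (Site.shift y i, j) = W (Site.shift y i, j))
    (h3 : V (Site.shift y j, i) = W (Site.shift y j, i)) (h4 : V (y, j) = W (y, j)) :
    plaquetteHolonomy V y i j = plaquetteHolonomy W y i j := by
  unfold plaquetteHolonomy
  rw [h1, h2, h3, h4]

/-- The phase colour advances by one along every positive unit step. -/
theorem phaseColour_shift {M : ℕ} (hwM : w ∣ M) (y : Site d M) (i : Fin d) :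
    ZMod.castHom hwM (ZMod w) (∑ j, (Site.shift y i) j) = ZMod.castHom hwM (ZMod w) (∑ j, y j) + 1 := by
  simp only [Site.shift, Pi.add_apply, Finset.sum_add_distrib, Finset.sum_pi_single', Finset.mem_univ,
    if_true, map_add, map_one]

/-- **(ρloc) for MASKED window-stencil conditioners**: if the feature map at a site of colour `c` only
reads the plaquettes that are FROZEN for the layer `s` — planes not containing the active direction
`μf s`, and, in the planes containing it, the plaquettes whose two `μf s`-links have colours
`c, c+1 ≠ bf s` (the engine's `residual_context_flat` mask) — then the weights at the ACTIVE links of the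
layer do not read the active links: fields agreeing off the active links give the same weights there. -/
theorem stencilConditioner_family_maskLocal
    (hfeat : ∀ (s : σ) (c : ZMod w) (P P' : Fin d → Fin d → G),
      (∀ μ' ν' : Fin d, μ' ≠ ν' → ((μf s ≠ μ' ∧ μf s ≠ ν') ∨ (c ≠ bf s ∧ c + 1 ≠ bf s)) → P μ' ν' = P' μ' ν') →
      feat s c P = feat s c P') :
    ∀ (M : ℕ) (hwM : w ∣ M) (s : σ) (V W : GaugeConfig d M G),
      (∀ j : Edge d M, ¬(j.2 = μf s ∧ ZMod.castHom hwM (ZMod w) (∑ i, j.1 i) = bf s) → V j = W j) →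
        ∀ e : Edge d M, (e.2 = μf s ∧ ZMod.castHom hwM (ZMod w) (∑ i, e.1 i) = bf s) → ∀ (ν : Fin d) (t : Fin 2),
        (ψ s e.2 ν t (fun z : {z : Fin d → ℤ // ∀ i, |z i| ≤ ((m : ℕ) : ℤ)} =>
          feat s (ZMod.cast (∑ j, (e.1 + (fun i => ((z.1 i : ℤ) : ZMod M))) j) : ZMod w) (fun μ' ν' => plaquetteHolonomy V (e.1 + (fun i => ((z.1 i : ℤ) : ZMod M))) μ' ν'))) =
        (ψ s e.2 ν t (fun z : {z : Fin d → ℤ // ∀ i, |z i| ≤ ((m : ℕ) : ℤ)} =>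
          feat s (ZMod.cast (∑ j, (e.1 + (fun i => ((z.1 i : ℤ) : ZMod M))) j) : ZMod w) (fun μ' ν' => plaquetteHolonomy W (e.1 + (fun i => ((z.1 i : ℤ) : ZMod M))) μ' ν'))) := by
  intro M hwM s V W hVW e _ ν t
  congr 1
  funext ζ
  -- the site read by this window entry and its colour
  have hc : (ZMod.cast (∑ j, (e.1 + fun i => ((ζ.1 i : ℤ) : ZMod M)) j) : ZMod w) =
      ZMod.castHom hwM (ZMod w) (∑ j, (e.1 + fun i => ((ζ.1 i : ℤ) : ZMod M)) j) := by
    rw [ZMod.castHom_apply]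
  rw [hc]
  refine hfeat s _ _ _ fun μ' ν' hne hfr => ?_
  -- every link of a frozen plaquette is inactive
  have hin : ∀ j : Edge d M, (j.2 ≠ μf s ∨ ZMod.castHom hwM (ZMod w) (∑ i, j.1 i) ≠ bf s) → V j = W j :=
    fun j hj => hVW j (fun h => hj.elim (fun h2 => h2 h.1) (fun hc' => hc' h.2))
  have hcol := phaseColour_shift w hwM (e.1 + fun i => ((ζ.1 i : ℤ) : ZMod M))
  rcases hfr with ⟨hμ, hν⟩ | ⟨hc0, hc1⟩
  · exact plaquetteHolonomy_congr_links (hin _ (Or.inl (Ne.symm hμ))) (hin _ (Or.inl (Ne.symm hν)))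
      (hin _ (Or.inl (Ne.symm hμ))) (hin _ (Or.inl (Ne.symm hν)))
  · by_cases hμ : μf s = μ'
    · subst hμ
      exact plaquetteHolonomy_congr_links (hin _ (Or.inr hc0)) (hin _ (Or.inl (Ne.symm hne)))
        (hin _ (Or.inr (by rw [hcol]; exact hc1))) (hin _ (Or.inl (Ne.symm hne)))
    · by_cases hν' : μf s = ν'
      · subst hν'
        exact plaquetteHolonomy_congr_links (hin _ (Or.inl (Ne.symm hμ))) (hin _ (Or.inr (by rw [hcol]; exact hc1)))
          (hin _ (Or.inl (Ne.symm hμ))) (hin _ (Or.inr hc0))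
      · exact plaquetteHolonomy_congr_links (hin _ (Or.inl (Ne.symm hμ))) (hin _ (Or.inl (Ne.symm hν')))
          (hin _ (Or.inl (Ne.symm hμ))) (hin _ (Or.inl (Ne.symm hν')))

end Masked

/-! ## §4 Measurability of the stencil weights (ρm) from measurable features and readout -/

section Measurable

variable {d : ℕ} (w : ℕ) {G : Type*} [Group G] [MeasurableSpace G] [MeasurableMul₂ G] [MeasurableInv G]
  {σ : Type*} {Φ : Type*} [MeasurableSpace Φ] (m : ℕ)
  (feat : σ → ZMod w → (Fin d → Fin d → G) → Φ)
  (ψ : σ → Fin d → Fin d → Fin 2 → ({z : Fin d → ℤ // ∀ i, |z i| ≤ ((m : ℕ) : ℤ)} → Φ) → ℝ)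

/-- A plaquette holonomy is a measurable function of the field (measurable multiplication / inversion). -/
theorem measurable_plaquetteHolonomy_apply {M : ℕ} (y : Site d M) (i j : Fin d) :
    Measurable fun V : GaugeConfig d M G => plaquetteHolonomy V y i j := by
  have hV : ∀ e : Edge d M, Measurable fun V : GaugeConfig d M G => V e := fun e => measurable_pi_apply e
  unfold plaquetteHolonomy
  exact (((hV _).mul (hV _)).mul (hV _).inv).mul (hV _).inv

/-- **(ρm) for window-stencil conditioners**: measurable per-site feature maps and measurable readouts give
measurable weights, on every torus. -/
theorem stencilConditioner_family_measurable
    (hfeat : ∀ (s : σ) (c : ZMod w), Measurable (feat s c))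
    (hψ : ∀ (s : σ) (μ ν : Fin d) (t : Fin 2), Measurable (ψ s μ ν t)) :
    ∀ (M : ℕ) (s : σ) (e : Edge d M) (ν : Fin d) (t : Fin 2), Measurable fun V : GaugeConfig d M G =>
      (ψ s e.2 ν t (fun z : {z : Fin d → ℤ // ∀ i, |z i| ≤ ((m : ℕ) : ℤ)} =>
          feat s (ZMod.cast (∑ j, (e.1 + (fun i => ((z.1 i : ℤ) : ZMod M))) j) : ZMod w) (fun μ' ν' => plaquetteHolonomy V (e.1 + (fun i => ((z.1 i : ℤ) : ZMod M))) μ' ν'))) := by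
  intro M s e ν t
  refine (hψ s e.2 ν t).comp (measurable_pi_lambda _ fun ζ => ?_)
  exact (hfeat s _).comp (measurable_pi_lambda _ fun μ' => measurable_pi_lambda _ fun ν' =>
    measurable_plaquetteHolonomy_apply _ μ' ν')

end Measurable

end Summit.Ventures.LatticeQCDFlow.Exactness
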